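import Mathlib.LinearAlgebra.Matrix.Determinant.Basic
import Mathlib.Tactic
import HarnessLib

/-!
# The quadric cone through the norm-form sextic (CC note §26.7 ERRATUM 3 ∕ precision P-tw2-T13c-1)

Kernel leaf for the W1 twisted squad (cell `pub-hsemireg`, seat w1-tw-2 gen 13). In the W₄-translate programme the space of
norm forms is `Λ = ⟨G(z²), z·G̃₁(z²), z·G̃₂(z²), z·G̃₃(z²)⟩` with `G(s) = (s - K₁)(s - K₂)(s - K₃)` and `G̃ₐ = G / (s - Kₐ)`, and
`ev : z ↦ (G(z²), zG̃₁(z²), zG̃₂(z²), zG̃₃(z²))` is the rational sextic `Γ_ev ⊂ ℙ³`. The algebraic skeleton of ERRATUM 3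
(«`Γ_ev` lies on the quadric cone with vertex `n₀ = (1:0:0:0)`; every line carrying three points of `Γ_ev` is a ruling,
i.e. a node chord `{n₀, ev(z), ev(-z)}`»), used in §26.8 (T13c)(i) in place of an external trisecant lemma, is:

* `ev_on_cone`: the coordinates of `ev(z)` satisfy `(K₁-K₂)X₁X₂ + (K₃-K₁)X₁X₃ + (K₂-K₃)X₂X₃ = 0` identically — a quadric
  with no `X₀`, i.e. a cone with vertex `(1:0:0:0)`;
* `cone_det`: the Gram matrix of that ternary form has determinant `2(K₁-K₂)(K₃-K₁)(K₂-K₃)`, non-zero for distinct `Kₐ`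
  (`cone_det_ne_zero`), so the cone is irreducible with vertex exactly `n₀`;
* `ev_antipodal_chord`: `ev(z) + ev(-z) = 2G(z²)·(1,0,0,0)` — the points `ev(z)`, `ev(-z)` and the vertex are collinear
  (the rulings are the antipodal chords), and `ev_zero_vertex`: `ev(0)` is a multiple of the vertex.

Honest framing: polynomial identities over a commutative ring ∕ a field (theorems only); the geometric step «a line with three
points on an irreducible quadric cone is a ruling» (Bézout) is not formalised here; nothing here bears on HC / HC_CM / HC_AV.
-/

namespace Summit.Ventures.HSemireg.NormFormQuadricCone

/-- `Γ_ev` lies on the cone: with `X₁ = z(z²-K₂)(z²-K₃)`, `X₂ = z(z²-K₁)(z²-K₃)`, `X₃ = z(z²-K₁)(z²-K₂)` one has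
`(K₁-K₂)X₁X₂ + (K₃-K₁)X₁X₃ + (K₂-K₃)X₂X₃ = 0`. -/
theorem ev_on_cone {R : Type*} [CommRing R] (K₁ K₂ K₃ z : R) :
    (K₁ - K₂) * (z * ((z ^ 2 - K₂) * (z ^ 2 - K₃))) * (z * ((z ^ 2 - K₁) * (z ^ 2 - K₃))) +
      (K₃ - K₁) * (z * ((z ^ 2 - K₂) * (z ^ 2 - K₃))) * (z * ((z ^ 2 - K₁) * (z ^ 2 - K₂))) +
      (K₂ - K₃) * (z * ((z ^ 2 - K₁) * (z ^ 2 - K₃))) * (z * ((z ^ 2 - K₁) * (z ^ 2 - K₂))) = 0 := by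
  ring

/-- The same identity for arbitrary `X₁, X₂, X₃` of the shape `Xₐ = z·G(z²)/(z² - Kₐ)`: if `Xₐ·(z² - Kₐ) = W` for a common
`W` (here `W = z·G(z²)`), then `(K₁-K₂)X₁X₂ + (K₃-K₁)X₁X₃ + (K₂-K₃)X₂X₃` is killed by `(z²-K₁)(z²-K₂)(z²-K₃)`. -/
theorem cone_form_mul_eq_zero {R : Type*} [CommRing R] (K₁ K₂ K₃ s W X₁ X₂ X₃ : R)
    (h₁ : X₁ * (s - K₁) = W) (h₂ : X₂ * (s - K₂) = W) (h₃ : X₃ * (s - K₃) = W) :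
    ((s - K₁) * (s - K₂) * (s - K₃)) *
      ((K₁ - K₂) * X₁ * X₂ + (K₃ - K₁) * X₁ * X₃ + (K₂ - K₃) * X₂ * X₃) = 0 := by
  have e : ((s - K₁) * (s - K₂) * (s - K₃)) *
      ((K₁ - K₂) * X₁ * X₂ + (K₃ - K₁) * X₁ * X₃ + (K₂ - K₃) * X₂ * X₃) =
      (K₁ - K₂) * (X₁ * (s - K₁)) * (X₂ * (s - K₂)) * (s - K₃) +
        (K₃ - K₁) * (X₁ * (s - K₁)) * (X₃ * (s - K₃)) * (s - K₂) +
        (K₂ - K₃) * (X₂ * (s - K₂)) * (X₃ * (s - K₃)) * (s - K₁) := by ring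
  rw [e, h₁, h₂, h₃]; ring

/-- The Gram matrix of the ternary form `(K₁-K₂)X₁X₂ + (K₃-K₁)X₁X₃ + (K₂-K₃)X₂X₃` (off-diagonal entries `a, b, c`, zero
diagonal) has determinant `2abc`. -/
theorem cone_det {R : Type*} [CommRing R] (a b c : R) :
    Matrix.det !![(0 : R), a, b; a, 0, c; b, c, 0] = 2 * a * b * c := by
  simp [Matrix.det_fin_three]; ring

/-- For pairwise distinct `K₁, K₂, K₃` in a field of characteristic `≠ 2` the cone is non-degenerate as a ternary form
(irreducible quadric cone with vertex exactly `(1:0:0:0)`). -/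
theorem cone_det_ne_zero {F : Type*} [Field F] [NeZero (2 : F)] (K₁ K₂ K₃ : F)
    (h₁₂ : K₁ ≠ K₂) (h₁₃ : K₁ ≠ K₃) (h₂₃ : K₂ ≠ K₃) :
    Matrix.det !![(0 : F), K₁ - K₂, K₃ - K₁; K₁ - K₂, 0, K₂ - K₃; K₃ - K₁, K₂ - K₃, 0] ≠ 0 := by
  rw [cone_det]
  have h2 : (2 : F) ≠ 0 := NeZero.ne 2
  have a : K₁ - K₂ ≠ 0 := sub_ne_zero.mpr h₁₂
  have b : K₃ - K₁ ≠ 0 := sub_ne_zero.mpr (Ne.symm h₁₃)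
  have c : K₂ - K₃ ≠ 0 := sub_ne_zero.mpr h₂₃
  exact mul_ne_zero (mul_ne_zero (mul_ne_zero h2 a) b) c

/-- The antipodal chord passes through the vertex: `ev(z) + ev(-z) = 2·G(z²)·(1,0,0,0)`, coordinate by coordinate. -/
theorem ev_antipodal_chord {R : Type*} [CommRing R] (K₁ K₂ K₃ z : R) :
    ((z ^ 2 - K₁) * (z ^ 2 - K₂) * (z ^ 2 - K₃) + ((-z) ^ 2 - K₁) * ((-z) ^ 2 - K₂) * ((-z) ^ 2 - K₃),
      z * ((z ^ 2 - K₂) * (z ^ 2 - K₃)) + (-z) * (((-z) ^ 2 - K₂) * ((-z) ^ 2 - K₃)),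
      z * ((z ^ 2 - K₁) * (z ^ 2 - K₃)) + (-z) * (((-z) ^ 2 - K₁) * ((-z) ^ 2 - K₃)),
      z * ((z ^ 2 - K₁) * (z ^ 2 - K₂)) + (-z) * (((-z) ^ 2 - K₁) * ((-z) ^ 2 - K₂))) =
      (2 * ((z ^ 2 - K₁) * (z ^ 2 - K₂) * (z ^ 2 - K₃)), 0, 0, 0) := by
  refine Prod.ext ?_ (Prod.ext ?_ (Prod.ext ?_ ?_)) <;> simp only <;> ring

/-- The node: `ev(0) = (-K₁K₂K₃)·(1,0,0,0)` is a multiple of the vertex (and so is the leading-coefficient vector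
`ev(∞) = (1,0,0,0)`), so `n₀ = ev(0) = ev(∞)` is the vertex of the cone. -/
theorem ev_zero_vertex {R : Type*} [CommRing R] (K₁ K₂ K₃ : R) :
    (((0 : R) ^ 2 - K₁) * ((0 : R) ^ 2 - K₂) * ((0 : R) ^ 2 - K₃),
      (0 : R) * (((0 : R) ^ 2 - K₂) * ((0 : R) ^ 2 - K₃)),
      (0 : R) * (((0 : R) ^ 2 - K₁) * ((0 : R) ^ 2 - K₃)),
      (0 : R) * (((0 : R) ^ 2 - K₁) * ((0 : R) ^ 2 - K₂))) = (-(K₁ * K₂ * K₃), 0, 0, 0) := by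
  refine Prod.ext ?_ (Prod.ext ?_ (Prod.ext ?_ ?_)) <;> simp only <;> ring

end Summit.Ventures.HSemireg.NormFormQuadricCone
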